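import Literature.Topology.FourManifolds.LatticeFormsTwist
import Literature.Topology.FourManifolds.LatticeFormsHyperbolicEmbedding
import Literature.Topology.FourManifolds.LatticeFormsCodimOneSignature
import Literature.Topology.FourManifolds.LatticeFormsOrthoSumSignature
import Literature.Topology.FourManifolds.LatticeFormsDefinite
import Literature.Topology.FourManifolds.LatticeFormsIndefiniteProofs
import HarnessLib

/-!
# Signature of overlattices and of glued lattices; `II_{n,n} ≃ U^{⊕ n}` (Huybrechts, K3, Ch. 14 §0.2,
# Cor. 1.3 (i); Serre, Ch. V §1.3.2, §2.2 Thm. 6)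

Trunk T-4MAN vocabulary, in the `Λ^*`-model of `LatticeFormsOverlattices.lean` /
`LatticeFormsOrthogonalLattices.lean` / `LatticeFormsTwist.lean` (`integralForm`, `graphForm`, `Λ ⊕ Λ(−1)`) and
with `U^{⊕ n} = hyperbolicSum n` of
`LatticeFormsHyperbolicEmbedding.lean`. Written for lane `lit-hodgefound` (Track 2 foundations; prover seat
`lit-hodgefound-p18`, gen 26, row g26-#15). THEOREMS ONLY — no new definition, no named fact.

## Contents

* §1 **overlattices keep the signature**: for `B` nondegenerate symmetric on `Λ` and a module
  `i_Λ(Λ) ⊆ Γ ⊆ Λ^*` on which the `ℚ`-valued form is integral, `σ(Γ) = σ(Λ)` (`signature_integralForm`) —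
  `Λ ⊂ Γ` has finite index and the signature is read off `Λ ⊗ ℝ = Γ ⊗ ℝ` (the tree's
  `signature_eq_of_comp_of_finiteIndex`, Serre Ch. V §1.3.2); `σ(L_H) = σ(L)` (`signature_integralForm_overlattice`).
* §2 **glued lattices**: `σ(L_{Γ_γ}) = σ(Λ₁) + σ(Λ₂)` for the overlattice `Λ₁ ⊕ Λ₂ ⊂ L_{Γ_γ}` of an
  anti-isometry `γ : A_{Λ₁} ⥲ A_{Λ₂}` (`signature_graphForm`); in particular every lattice between
  `Λ ⊕ Λ(−1)` and its dual has signature `0` (`signature_integralForm_prod_neg`) and rank `2 rk Λ`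
  (`finrank_integralForm_prod_neg`).
* §3 **`II_{n,n} ≃ U^{⊕ n}`** (Huybrechts Cor. 1.3 (i) for `τ = 0`; Serre Ch. V §2.2 Thm. 6): an even unimodular
  symmetric lattice of signature `0` and rank `2n > 0` is isometric to `U^{⊕ n}`
  (`equivalent_hyperbolicSum_of_signature_eq_zero`, from the tree's classification
  `equivalent_of_isIndefinite_holds`); `U^{⊕ (n+1)} ≃ U^{⊕ n} ⊕ U` links the coordinate model with the tree's
  iterated `prod`s of `hyperbolicForm` (`hyperbolicSum_succ_equivalent_prod_hyperbolicForm`); hence the even unimodular overlattice `Λ ⊕ Λ(−1) ⊂ Γ` of §0.3 (iv) is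
  `≃ U^{⊕ rk Λ}` for `Λ ≠ 0` (`integralForm_prod_neg_equivalent_hyperbolicSum`).

## References

* [Huybrechts2016K3] D. Huybrechts, Lectures on K3 Surfaces, CUP 2016, Ch. 14 §0.2–§0.3, Cor. 1.3 (i) (PDF
  pp. 333–337).
* [Serre1973] J.-P. Serre, A Course in Arithmetic, GTM 7, Springer 1973, Ch. V §1.3.2, §2.2 Thm. 6.
-/

noncomputable section

open Module Function
open LinearMap (BilinForm)
open Literature.Topology.FourManifolds (hyperbolicForm)

namespace LinearMap.BilinForm

/-! ### §1 Overlattices keep the signature -/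

section Overlattice

variable {P : Type*} [AddCommGroup P] [Module ℤ P] (B : BilinForm ℤ P) [Module.Finite ℤ P] [Module.Free ℤ P]

/-- **`σ(Γ) = σ(Λ)` for `i_Λ(Λ) ⊆ Γ ⊆ Λ^*`** (`B` nondegenerate symmetric, the `ℚ`-valued form integral on
`Γ`): `i_Λ : Λ → Γ` is isometric with image of finite index `[Γ : Λ] = |Γ/Λ|`, and the signature does not see
finite index. [cite: Serre1973, Ch. V §1.3.2] [cite: Huybrechts2016K3, Ch. 14 §0.2 ("finite index even overlattices")] -/
theorem signature_integralForm (hB : B.Nondegenerate) (hs : B.IsSymm) (Γ : Submodule ℤ (Module.Dual ℤ P))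
    (hle : LinearMap.range B ≤ Γ) (hΓ : ∀ f ∈ Γ, ∀ g ∈ Γ, ∃ n : ℤ, B.dualForm f g = n) :
    (B.integralForm Γ hΓ).signature = B.signature := by
  refine (signature_eq_of_comp_of_finiteIndex B (B.integralForm Γ hΓ) (B.toOverlattice Γ hle)
    (fun x y ↦ B.integralForm_toOverlattice hB hs Γ hle hΓ x y) fun γ ↦ ?_).symm
  refine ⟨(LinearMap.range (B.toOverlattice Γ hle)).toAddSubgroup.index, ?_, ?_⟩
  · exact_mod_cast B.index_range_toOverlattice_ne_zero hB Γ hle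
  · rw [Nat.cast_smul_eq_nsmul]
    exact (LinearMap.range (B.toOverlattice Γ hle)).toAddSubgroup.nsmul_index_mem γ

/-- **`σ(L_H) = σ(L)`** for the overlattice `L_H = π⁻¹(H)` of a subgroup `H ⊂ A_L` on which the form is
integral (e.g. `H` isotropic). [cite: Serre1973, Ch. V §1.3.2] [cite: Kondo2013K3Enriques, §2.7 ("an overlattice `L_H` of `L`")] -/
theorem signature_integralForm_overlattice (hB : B.Nondegenerate) (hs : B.IsSymm)
    (H : Submodule ℤ B.discriminantGroup)
    (hΓ : ∀ f ∈ B.overlattice H, ∀ g ∈ B.overlattice H, ∃ n : ℤ, B.dualForm f g = n) :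
    (B.integralForm (B.overlattice H) hΓ).signature = B.signature :=
  B.signature_integralForm hB hs (B.overlattice H) (B.range_le_overlattice H) hΓ

end Overlattice

/-! ### §2 Glued lattices: `σ(L_{Γ_γ}) = σ(Λ₁) + σ(Λ₂)`; `Λ ⊕ Λ(−1) ⊂ Γ` has signature `0` -/

section Glued

variable {P₁ : Type*} [AddCommGroup P₁] {P₂ : Type*} [AddCommGroup P₂] (B₁ : BilinForm ℤ P₁) (B₂ : BilinForm ℤ P₂)
  [Module.Finite ℤ P₁] [Module.Free ℤ P₁] [Module.Finite ℤ P₂] [Module.Free ℤ P₂]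

/-- **`σ(L) = σ(Λ₁) + σ(Λ₂)`** for the unimodular overlattice `Λ₁ ⊕ Λ₂ ⊂ L = L_{Γ_γ}` of an anti-isometry
`γ : (A_{Λ₁}, b₁) ⥲ (A_{Λ₂}, −b₂)` (finite index over `Λ₁ ⊕ Λ₂`, whose signature is additive).
[cite: Huybrechts2016K3, Ch. 14 §0.2 (proof of Prop. 0.2)] [cite: Serre1973, Ch. V §1.3.2, §1.3.7] -/
theorem signature_graphForm (h₁ : B₁.Nondegenerate) (hs₁ : B₁.IsSymm) (h₂ : B₂.Nondegenerate) (hs₂ : B₂.IsSymm)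
    (e : B₁.discriminantGroup ≃ₗ[ℤ] B₂.discriminantGroup)
    (hb : ∀ a c, B₂.discriminantBilin h₂ hs₂ (e a) (e c) = -B₁.discriminantBilin h₁ hs₁ a c) :
    (B₁.graphForm B₂ h₁ hs₁ h₂ hs₂ e hb).signature = B₁.signature + B₂.signature := by
  rw [graphForm, signature_integralForm (B₁.prod B₂) (h₁.prod h₂) (hs₁.prod hs₂) _
    (B₁.range_prod_le_graphOverlattice B₂ e), signature_prod B₁ B₂ hs₁ hs₂]

variable {P : Type*} [AddCommGroup P] (B : BilinForm ℤ P) [Module.Finite ℤ P] [Module.Free ℤ P]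

/-- **Every lattice `Γ` between `Λ ⊕ Λ(−1)` and its dual (integral `ℚ`-form) has signature `0`**:
`σ(Γ) = σ(Λ ⊕ Λ(−1)) = σ(Λ) − σ(Λ) = 0`. Applies to the even unimodular `Γ ⊃ Λ ⊕ Λ(−1)` of
`exists_primitiveEmbedding_prod_neg`. [cite: Huybrechts2016K3, Ch. 14 §0.3 (iv)] [cite: Serre1973, Ch. V §1.3.2, §1.3.7] -/
theorem signature_integralForm_prod_neg (hB : B.Nondegenerate) (hs : B.IsSymm)
    (Γ : Submodule ℤ (Module.Dual ℤ (P × P))) (hle : LinearMap.range (B.prod (-B)) ≤ Γ)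
    (hΓ : ∀ f ∈ Γ, ∀ g ∈ Γ, ∃ n : ℤ, (B.prod (-B)).dualForm f g = n) :
    ((B.prod (-B)).integralForm Γ hΓ).signature = 0 := by
  rw [signature_integralForm (B.prod (-B)) (hB.prod ((B.nondegenerate_neg_iff).2 hB)) (hs.prod hs.neg) Γ hle,
    signature_prod B (-B) hs hs.neg, signature_neg, add_neg_cancel]

/-- **… and rank `2 rk Λ`.** [cite: Huybrechts2016K3, Ch. 14 §0.3 (iv)] -/
theorem finrank_integralForm_prod_neg (hB : B.Nondegenerate) (Γ : Submodule ℤ (Module.Dual ℤ (P × P)))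
    (hle : LinearMap.range (B.prod (-B)) ≤ Γ) : finrank ℤ Γ = 2 * finrank ℤ P := by
  rw [(B.prod (-B)).finrank_overlattice_eq (hB.prod ((B.nondegenerate_neg_iff).2 hB)) Γ hle, Module.finrank_prod]
  ring

end Glued

/-! ### §3 `II_{n,n} ≃ U^{⊕ n}` (Huybrechts Cor. 1.3 (i), `τ = 0`) -/

section Classification

variable {V : Type*} [AddCommGroup V] [Module ℤ V] [Module.Finite ℤ V] [Module.Free ℤ V] (Q : BilinForm ℤ V)

/-- **`II_{n,n} ≃ U^{⊕ n}`** (Huybrechts Cor. 1.3 (i) for index `τ = 0`: "if `Λ` is even of index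
`τ = n₊ − n₋`, then … `Λ ≃ E₈^{⊕ τ/8} ⊕ U^{⊕ n₋}`"; Serre Ch. V §2.2 Thm. 6): a symmetric even unimodular
lattice of signature `0` and rank `2n > 0` is isometric to `U^{⊕ n}` — both are indefinite
(`|σ| = 0 < rank`), unimodular, even, of the same rank and signature, so the tree's classification of
indefinite unimodular lattices (`equivalent_of_isIndefinite_holds`) applies.
[cite: Huybrechts2016K3, Ch. 14 Cor. 1.3 (i)] [cite: Serre1973, Ch. V §2.2 Thm. 6] -/
theorem equivalent_hyperbolicSum_of_signature_eq_zero (hs : Q.IsSymm) (hu : Q.IsUnimodular) (he : Q.IsEven)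
    {n : ℕ} (hn : 0 < n) (hrank : finrank ℤ V = 2 * n) (hsig : Q.signature = 0) :
    Q.Equivalent (hyperbolicSum n) := by
  have hi : Q.IsIndefinite := by
    rw [isIndefinite_iff_abs_signature_lt_finrank hs hu.separatingLeft, hsig, hrank, abs_zero]
    exact_mod_cast Nat.mul_pos two_pos hn
  have hi' : (hyperbolicSum n).IsIndefinite := by
    rw [isIndefinite_iff_abs_signature_lt_finrank (isSymm_hyperbolicSum n)
      (isUnimodular_hyperbolicSum n).separatingLeft, signature_hyperbolicSum, finrank_hyperbolicSum_carrier,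
      abs_zero]
    exact_mod_cast Nat.mul_pos two_pos hn
  exact equivalent_of_isIndefinite_holds hs hu hi (isSymm_hyperbolicSum n) (isUnimodular_hyperbolicSum n) hi'
    (hrank.trans (finrank_hyperbolicSum_carrier n).symm) (hsig.trans (signature_hyperbolicSum n).symm)
    ⟨fun _ ↦ isEven_hyperbolicSum n, fun _ ↦ he⟩

/-- **`U^{⊕ (n+1)} ≃ U^{⊕ n} ⊕ U`**: the coordinate model `hyperbolicSum` agrees with the tree's iterated
orthogonal sums of the hyperbolic plane `hyperbolicForm` (both sides are even unimodular of signature `0` and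
rank `2n + 2`, so §3 applies; with `hyperbolicSum_one_equivalent_hyperbolicForm` this identifies `hyperbolicSum n`
with `U ⊕ ⋯ ⊕ U` by induction). [cite: Huybrechts2016K3, Ch. 14 §0.3 (ii), Cor. 1.3 (i)] [cite: Serre1973, Ch. V §2.2 Thm. 6] -/
theorem hyperbolicSum_succ_equivalent_prod_hyperbolicForm (n : ℕ) :
    (hyperbolicSum (n + 1)).Equivalent ((hyperbolicSum n).prod hyperbolicForm) := by
  refine (equivalent_hyperbolicSum_of_signature_eq_zero ((hyperbolicSum n).prod hyperbolicForm)
    ((isSymm_hyperbolicSum n).prod Literature.Topology.FourManifolds.isSymm_hyperbolicForm)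
    (isUnimodular_prod_iff.2 ⟨isUnimodular_hyperbolicSum n,
      Literature.Topology.FourManifolds.isUnimodular_hyperbolicForm_holds⟩)
    (isEven_prod_iff.2 ⟨isEven_hyperbolicSum n, Literature.Topology.FourManifolds.isEven_hyperbolicForm⟩)
    (Nat.succ_pos n) ?_ ?_).symm
  · rw [Module.finrank_prod, finrank_hyperbolicSum_carrier, Module.finrank_fin_fun]
    omega
  · rw [signature_prod _ _ (isSymm_hyperbolicSum n) Literature.Topology.FourManifolds.isSymm_hyperbolicForm,
      signature_hyperbolicSum]
    exact (zero_add _).trans Literature.Topology.FourManifolds.signature_hyperbolicForm_holds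

variable {P : Type*} [AddCommGroup P] (B : BilinForm ℤ P) [Module.Finite ℤ P] [Module.Free ℤ P]

/-- **The even unimodular overlattice `Λ ⊕ Λ(−1) ⊂ Γ` is `≃ U^{⊕ rk Λ}`** (`Λ ≠ 0` nondegenerate): any
symmetric even unimodular `Γ` between `Λ ⊕ Λ(−1)` and its dual — such as the one produced by
`exists_primitiveEmbedding_prod_neg` — has signature `0` and rank `2 rk Λ` (§2), hence is `II_{r,r} ≃ U^{⊕ r}`.
[cite: Huybrechts2016K3, Ch. 14 §0.3 (iv), Cor. 1.3 (i)] [cite: Serre1973, Ch. V §2.2 Thm. 6] -/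
theorem integralForm_prod_neg_equivalent_hyperbolicSum (hB : B.Nondegenerate) (hs : B.IsSymm)
    (hP : 0 < finrank ℤ P) (Γ : Submodule ℤ (Module.Dual ℤ (P × P))) (hle : LinearMap.range (B.prod (-B)) ≤ Γ)
    (hΓ : ∀ f ∈ Γ, ∀ g ∈ Γ, ∃ n : ℤ, (B.prod (-B)).dualForm f g = n)
    (hu : ((B.prod (-B)).integralForm Γ hΓ).IsUnimodular) (he : ((B.prod (-B)).integralForm Γ hΓ).IsEven) :
    ((B.prod (-B)).integralForm Γ hΓ).Equivalent (hyperbolicSum (finrank ℤ P)) :=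
  equivalent_hyperbolicSum_of_signature_eq_zero _
    ((B.prod (-B)).isSymm_integralForm (hB.prod ((B.nondegenerate_neg_iff).2 hB)) (hs.prod hs.neg) Γ hΓ) hu he
    hP (B.finrank_integralForm_prod_neg hB Γ hle) (B.signature_integralForm_prod_neg hB hs Γ hle hΓ)

end Classification

end LinearMap.BilinForm
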